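import Summits.CriticalPhenomena.PercolationContinuityZ3.Theorems.Transplant.SkelKitResiduesO
import Summits.CriticalPhenomena.PercolationContinuityZ3.Theorems.Transplant.SkelKitResidues
import Summits.CriticalPhenomena.PercolationContinuityZ3.Theorems.Transplant.SkelHabLevels
import Summits.CriticalPhenomena.PercolationContinuityZ3.Theorems.Transplant.KNCellsSchemeO
import Summits.CriticalPhenomena.PercolationContinuityZ3.Theorems.Transplant.KNCellsProcessO
import Summits.CriticalPhenomena.PercolationContinuityZ3.Theorems.Transplant.KNCellsRunO
import Summits.CriticalPhenomena.PercolationContinuityZ3.Theorems.Transplant.KNCellsRunInvO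
import Summits.CriticalPhenomena.PercolationContinuityZ3.Theorems.Transplant.KNCells2SchemeO
import Summits.CriticalPhenomena.PercolationContinuityZ3.Theorems.Transplant.KNCells2RunO
import Summits.CriticalPhenomena.PercolationContinuityZ3.Theorems.Transplant.KNCells2RunInvO
import Summits.CriticalPhenomena.PercolationContinuityZ3.Theorems.Transplant.KNCellsCoverO
import Summits.CriticalPhenomena.PercolationContinuityZ3.Theorems.Transplant.KNCells2CoverO
import Summits.CriticalPhenomena.PercolationContinuityZ3.Theorems.Transplant.KNCellsReachO
import Summits.CriticalPhenomena.PercolationContinuityZ3.Theorems.Transplant.KNCells2ReachO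
import Summits.CriticalPhenomena.PercolationContinuityZ3.Theorems.Transplant.KNCellsExitO
import Summits.CriticalPhenomena.PercolationContinuityZ3.Theorems.Transplant.KNCells2ExitO
import Summits.CriticalPhenomena.PercolationContinuityZ3.Theorems.Transplant.KNCellsStepsDefsO
import Summits.CriticalPhenomena.PercolationContinuityZ3.Theorems.Transplant.KNCellsStepsReachO
import Summits.CriticalPhenomena.PercolationContinuityZ3.Theorems.Transplant.KNCellsStepsPinO
import Summits.CriticalPhenomena.PercolationContinuityZ3.Theorems.Transplant.KNCellsStepsSubboxO
import Summits.CriticalPhenomena.PercolationContinuityZ3.Theorems.Transplant.KNCellsStepsChainO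
import Summits.CriticalPhenomena.PercolationContinuityZ3.Theorems.Transplant.KNCellsStepsFailO
import Summits.CriticalPhenomena.PercolationContinuityZ3.Theorems.Transplant.KNCells2StepsO
import Summits.CriticalPhenomena.PercolationContinuityZ3.Theorems.Transplant.KNCells2FailO
import Summits.CriticalPhenomena.PercolationContinuityZ3.Theorems.Transplant.KNCells2FacePrefixO
import Summits.CriticalPhenomena.PercolationContinuityZ3.Theorems.Transplant.KNCells2ThetaPosChosenO
import Summits.CriticalPhenomena.PercolationContinuityZ3.Theorems.Transplant.KNCells2KitAtRunO
import Summits.CriticalPhenomena.PercolationContinuityZ3.Theorems.Transplant.KNCells2CorridorO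
import Summits.CriticalPhenomena.PercolationContinuityZ3.Theorems.Transplant.KNCells2CorridorEdgeO
import Summits.CriticalPhenomena.PercolationContinuityZ3.Theorems.Transplant.KNCells2RootChainO
import Summits.CriticalPhenomena.PercolationContinuityZ3.Theorems.Transplant.SkelWinPackagingO
import Summits.CriticalPhenomena.PercolationContinuityZ3.Theorems.Transplant.SkelKitResiduesHab
import Literature.Probability.Percolation.OrientedHistorySiteRenormalizationRun
import Summits.CriticalPhenomena.PercolationContinuityZ3.Theorems.Transplant.SkelPhiWinStep
import Summits.CriticalPhenomena.PercolationContinuityZ3.Theorems.Transplant.SkelPhiFaceResidue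
import HarnessLib

/-!
# N2 (frames-only node `SamePDropOfSkeletonFrm₁`, OPEN) — ORIENTED MACRO LAYER (WAVE 0 (c1), (R-18) `q ≡ true`): the oriented twin of N1's `SkelKitResiduesHab`

builds on p205010 (kernel theorem, internal audit signed; external expert review pending) — nothing in this file uses p205010; NOTHING is claimed about the
open node `SamePDropOfSkeletonFrm₁` (`SamePDropOfSkeletonNeg₁` is CLOSED in the tree and untouched by this file).
Status sentence (coordinator 2026-08-20T04:30Z): "θ(p_c) = 0 on ℤ^d, all d ≥ 2 — kernel-verified (Lean 4/Mathlib, standard axioms); internal adversarial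
audit SIGNED 2026-08-20 04:29Z; external expert review pending."
Lane `prim-bschramm-*`, seat `prim-bschramm-stmt` (gen 19); helper file (`--supports stmt-CriticalPhenomena-4575 --as helper`); N2-SCOPE §20, (R-18)/(R-19).
PORT RULES (HOME/prim-bschramm-stmt-g19/lean/port_orient.py): the history-site API is replaced by its ORIENTED twin at the fixed quadrant `qNE := fun _ => true`
(`HState.choice ↦ HState.ochoice qNE`, `mstOf ↦ omstOf qNE`, `mst/stN ↦ omst/ostN qNE`, `occFinal ↦ ooccFinal qNE`, `Lawful ↦ OLawful qNE`, onward directions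
`onward ↦ onwardO` = the POSITIVE ones, (N2-e)); every declaration whose text changes thereby — directly or through a changed declaration — is re-declared with the
suffix `O` (same namespace); unchanged declarations of the N1 file are NOT repeated (the N1 module is imported). Docstrings/citations are N1's.
N1 HEADER (kept for the reader):
* `Skel.nmaxC := 1000`; `Skel.ReachOblAtH G S FD Δ' δ h e a' du`, `Skel.ReachOblRH G S FD Δ' δ` (run histories, chosen edge, onward `du`, at `aOf₂`);
* `reach_of_reachOblAtH` (one line over the core); **`Skel.kitAtRun_of_oblRH`** — `δc ≤ δ`, `hstep` (window graphs `winGraph G c Rπ`, as for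
  `FaceOblR`), `hchainH : ∀ n ≤ nmaxC, ∀ Ω, …` at `(δ ↦ ε'')`, `hchainr` (as for `RootOblT`), `RootOblT`, `FaceOblR`, `ReachOblRH` ⟹ `KitAtRun G S FD δ₂ ε''`.
[cite: KozmaNitzan2024, §4 (30), (32) (pp. 27–28), Lemma 10 (p. 17), Lemmas 11–12 (pp. 22–25), p. 30 (Steps III–IV)]
-/
noncomputable section

open MeasureTheory ProbabilityTheory
open scoped ENNReal Classical

namespace Summit.CriticalPhenomena.PercolationContinuityZ3.Theorems

namespace Transplant

namespace Skel

open Literature.Probability.Percolation Literature.Probability.LatticeModels SimpleGraph KNCells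
open GadgetSystem ProbeHistory HSiteScheme Contour

variable {V : Type} [DecidableEq V] [Countable V] {G : SimpleGraph V} [G.LocallyFinite] (Φ : PlanarSkeletonConc G)
variable {A : Type*}

/-! ## §1 The corridor residue, habitat form -/

variable (G) in
/-- **The corridor obligation at one probe `(h, e, a', du)`, habitat form**: for some length `n ≤ nmaxC` and some finite habitat `Ω`, a linked
chain of `n + 1` target steps in `winGraphIn G Ω` with common source the scheme's root, kits at accuracy `δ` under the corridor law `S.Wcor`,
true targets inside the enlarged ones with excess `≤ η ≤ δ/2`, the arrival cube `M^{aOf₁O}_{tgt e}` inside the first level and the last true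
target inside `M^{a'}_{tgt e + du}` — the hypotheses of `KSchA.hreach_of_chain_edge_subO` except the chain property and `δc ≤ δ`.
[cite: KozmaNitzan2024, §4 Lemma 12 (pp. 23–25), p. 30 (Step IV)] -/
def ReachOblAtHO (S : KSchA V A) (FD : FaceData V A) (Δ' : ℕ) (δ : ℝ) (h : ProbeHistory V) (e : Site 2 × MDir) (a' : A) (du : MDir) : Prop :=
  ∃ (n : ℕ) (_ : n ≤ nmaxC) (Ω : Finset V) (s : Fin (n + 1) → KNLevels.TStep (winGraphIn G Ω)) (T' : Fin (n + 1) → Finset V) (η : ℝ),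
    (∀ i : Fin (n + 1), (s i).L.o = S.Γ.root) ∧
    (∀ i : Fin n, T' (Fin.castSucc i) ⊆ (s i.succ).L.X 0) ∧ (∀ i : Fin (n + 1), T' i ⊆ (s i).T) ∧
    (∀ i : Fin (n + 1), (s i).KitsAt (S.Wcor G FD h e (S.aOf₁O G h e) a' du) S.p Δ' δ) ∧ η ≤ δ / 2 ∧
    (∀ i : Fin (n + 1), (prodBernoulli (S.Wcor G FD h e (S.aOf₁O G h e) a' du)).real (⋃ t ∈ (s i).T \ T' i, openConn S.Γ.root t) ≤ η) ∧
    S.Γ.M (S.aOf₁O G h e) (tgt e) ⊆ (s 0).L.X 0 ∧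
    T' (Fin.last n) ⊆ S.Γ.M a' (tgt e + stepVec du)

variable (G) in
/-- **The corridor obligations, run-restricted habitat form**: `ReachOblAtHO` for every RUN history whose chosen candidate is `e`, valid, and every
onward direction, at `a' = aOf₂O`.  THE node-facing (C) residue. [cite: KozmaNitzan2024, §4 p. 30 (Step IV), Lemma 12 (pp. 23–25)] -/
def ReachOblRHO (S : KSchA V A) (FD : FaceData V A) (Δ' : ℕ) (δ : ℝ) : Prop :=
  ∀ h e, S.IsRun₂O G h → (S.astOf₂O G h).st.ochoice KSchA.qNE = some e → S.Valid₂O G h e →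
    ∀ du ∈ S.onwardO G h (tgt e), ReachOblAtHO G S FD Δ' δ h e (S.aOf₂O G h e) du

/-! ## §2 Discharging `KitAtRun` from the residues (habitat form) -/

variable {Φ}
variable {S : KSchA V A} {FD : FaceData V A}
variable {h : ProbeHistory V} {e : Site 2 × MDir} {a' : A} {du : MDir}

omit Φ in
/-- **`ReachOblAtHO` + the chain properties of every length `n ≤ nmaxC` at `(δ ↦ ε'')` in every habitat window graph + `δc ≤ δ` ⟹ the corridor
bound `1 - ε'' < P_{Wfull}(Reach)`** (`KSchA.hreach_of_chain_edge_subO`). [cite: KozmaNitzan2024, §4 Lemma 12 (pp. 23–25), p. 30 (Step IV)] -/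
theorem reach_of_reachOblAtHO (hV : S.Valid₂O G h e) {Δ' : ℕ} {δ ε'' : ℝ} (hδc : S.δc ≤ δ)
    (hchain : ∀ n ≤ nmaxC, ∀ (Ω : Finset V) (Wg : Sym2 V → unitInterval) (s : Fin (n + 1) → KNLevels.TStep (winGraphIn G Ω))
      (T' : Fin (n + 1) → Finset V) (η : ℝ),
      (∀ i : Fin (n + 1), (s i).L.o = (s 0).L.o) →
      (∀ i : Fin n, T' (Fin.castSucc i) ⊆ (s i.succ).L.X 0) →
      (∀ i : Fin (n + 1), T' i ⊆ (s i).T) →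
      (∀ i : Fin (n + 1), (s i).KitsAt Wg S.p Δ' δ) →
      η ≤ δ / 2 →
      (∀ i : Fin (n + 1), (prodBernoulli Wg).real (⋃ t ∈ (s i).T \ T' i, openConn (s 0).L.o t) ≤ η) →
      1 - δ < (prodBernoulli Wg).real (s 0).L.reachB →
        1 - ε'' < (prodBernoulli Wg).real (⋃ t ∈ T' (Fin.last n), openConn (s 0).L.o t))
    (hR : ReachOblAtHO G S FD Δ' δ h e a' du) :
    1 - ε'' < (prodBernoulli (S.Wfull G h e (S.aOf₁O G h e) a' du)).real (S.Reach G FD h e (S.aOf₁O G h e) a' du) := by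
  obtain ⟨n, hn, Ω, s, T', η, ho, hlink, hsub, hkits, hη, hexc, hB0, hTn⟩ := hR
  exact KSchA.hreach_of_chain_edge_subO (winGraphIn G Ω) hV hδc (hchain n hn Ω) s T' ho hlink hsub hkits hη hexc hB0 hTn

/-- **The run-restricted obligations from the named residues, habitat form**: `δc ≤ δ`, the one-step property at `(δ₂ ↦ δc/2)` for the window
graphs, the chain properties of every length `n ≤ nmaxC` at `(δ ↦ ε'')` for the habitat window graphs, the chain properties of every length at
`(δr n ↦ δc)` for the window graphs, `RootOblTO … δr`, `FaceOblRO … δ₂` and `ReachOblRHO … δ` ⟹ p5-g3's `KitAtRunO G S FD δ₂ ε''`.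
[cite: KozmaNitzan2024, §4 (30), (32), Lemmas 10–12] -/
theorem kitAtRun_of_oblRHO {Δ' : ℕ} {δ δ₂ ε'' : ℝ} {δr : ℕ → ℝ} (hδc : S.δc ≤ δ)
    (hstep : ∀ (c : V) (Rπ : ℕ) (Wg : Sym2 V → unitInterval) (s : KNLevels.TStep (winGraph G c Rπ)), s.KitsAt Wg S.p Δ' δ₂ →
      1 - δ₂ < (prodBernoulli Wg).real s.L.reachB → 1 - S.δc / 2 < (prodBernoulli Wg).real (⋃ t ∈ s.T, openConn s.L.o t))
    (hchain : ∀ n ≤ nmaxC, ∀ (Ω : Finset V) (Wg : Sym2 V → unitInterval) (s : Fin (n + 1) → KNLevels.TStep (winGraphIn G Ω))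
      (T' : Fin (n + 1) → Finset V) (η : ℝ),
      (∀ i : Fin (n + 1), (s i).L.o = (s 0).L.o) →
      (∀ i : Fin n, T' (Fin.castSucc i) ⊆ (s i.succ).L.X 0) →
      (∀ i : Fin (n + 1), T' i ⊆ (s i).T) →
      (∀ i : Fin (n + 1), (s i).KitsAt Wg S.p Δ' δ) →
      η ≤ δ / 2 →
      (∀ i : Fin (n + 1), (prodBernoulli Wg).real (⋃ t ∈ (s i).T \ T' i, openConn (s 0).L.o t) ≤ η) →
      1 - δ < (prodBernoulli Wg).real (s 0).L.reachB →
        1 - ε'' < (prodBernoulli Wg).real (⋃ t ∈ T' (Fin.last n), openConn (s 0).L.o t))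
    (hchainr : ∀ (n : ℕ) (c : V) (Rπ : ℕ) (Wg : Sym2 V → unitInterval) (s : Fin (n + 1) → KNLevels.TStep (winGraph G c Rπ))
      (T' : Fin (n + 1) → Finset V) (η : ℝ),
      (∀ i : Fin (n + 1), (s i).L.o = (s 0).L.o) →
      (∀ i : Fin n, T' (Fin.castSucc i) ⊆ (s i.succ).L.X 0) →
      (∀ i : Fin (n + 1), T' i ⊆ (s i).T) →
      (∀ i : Fin (n + 1), (s i).KitsAt Wg S.p Δ' (δr n)) →
      η ≤ δr n / 2 →
      (∀ i : Fin (n + 1), (prodBernoulli Wg).real (⋃ t ∈ (s i).T \ T' i, openConn (s 0).L.o t) ≤ η) →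
      1 - δr n < (prodBernoulli Wg).real (s 0).L.reachB →
        1 - S.δc < (prodBernoulli Wg).real (⋃ t ∈ T' (Fin.last n), openConn (s 0).L.o t))
    (hQ0 : RootOblTO G S Δ' δr) (hface : FaceOblRO Φ S FD Δ' δ₂) (hreach : ReachOblRHO G S FD Δ' δ) :
    KSchA.KitAtRunO G S FD δ₂ ε'' := by
  refine And.intro (rootObl_of_rootOblTO hchainr hQ0) (And.intro ?_ ?_)
  · intro h e hrun hc hV du hdu j hj o hsrc
    exact cond_of_faceOblAt hstep (hface h e hrun hc hV du hdu j hj o) hsrc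
  · intro h e hrun hc hV du hdu
    exact reach_of_reachOblAtHO hV hδc hchain (hreach h e hrun hc hV du hdu)

end Skel

end Transplant

end Summit.CriticalPhenomena.PercolationContinuityZ3.Theorems

end

/-! ## (merged module) the oriented twin `SkelPhiFaceResidueO` — same port rules, header as in part 1 -/
noncomputable section

open MeasureTheory ProbabilityTheory
open scoped ENNReal Classical

namespace Summit.CriticalPhenomena.PercolationContinuityZ3.Theorems.Transplant

namespace Skelφ

open Literature.Probability.Percolation Literature.Probability.LatticeModels SimpleGraph KNCells
open GadgetSystem ProbeHistory HSiteScheme Contour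
open Skel (winGraph winGraphIn WinStepData RootOblT RootOblTO ReachOblRH ReachOblRHO nmaxC)

variable {V : Type} [DecidableEq V] [Countable V] (G : SimpleGraph V) [G.LocallyFinite] (φ : V → Site 2)
variable {A : Type*}

/-! ## §1 The face residue -/

/-- **The face obligations, run-restricted form** for the planar map `φ`: `FaceOblAt` for every RUN history whose chosen candidate is `e`, valid,
every onward direction, every `j < K` and every `o`, at the history anchors `(aOf₁O, aOf₂O)` (φ-level form of `Skel.FaceOblRO`). [this work] -/
def FaceOblRO (S : KSchA V A) (FD : FaceData V A) (Δ' : ℕ) (δ₂ : ℝ) : Prop :=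
  ∀ h e, S.IsRun₂O G h → (S.astOf₂O G h).st.ochoice KSchA.qNE = some e → S.Valid₂O G h e →
    ∀ du ∈ S.onwardO G h (tgt e), ∀ j < S.Γ.K, ∀ o : Finset (Sym2 V),
      FaceOblAt G φ S FD Δ' δ₂ h e (S.aOf₁O G h e) (S.aOf₂O G h e) du j o

/-! ## §2 The packaging: `cond` from the face residue; the run-restricted obligations from the three residues -/

variable {G φ}
variable {S : KSchA V A} {FD : FaceData V A}
variable {h : ProbeHistory V} {e : Site 2 × MDir} {a a' : A} {du : MDir}

/-- **The run-restricted obligations from the named residues, habitat form** (from `Lip`): `δc ≤ δ`, the one-step property at `(δ₂ ↦ δc/2)` for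
the window graphs, the chain properties of every length `n ≤ nmaxC` at `(δ ↦ ε'')` for the habitat window graphs, the chain properties of every
length at `(δr n ↦ δc)` for the window graphs, `Skel.RootOblTO … δr`, `Skelφ.FaceOblRO … δ₂` and `Skel.ReachOblRHO … δ` ⟹ p5-g3's
`KitAtRunO G S FD δ₂ ε''` (φ-level form of `Skel.kitAtRun_of_oblRHO`). [cite: KozmaNitzan2024, §4 (30), (32), Lemmas 10–12] -/
theorem kitAtRun_of_oblRHO (hlip : Lip G φ) {Δ' : ℕ} {δ δ₂ ε'' : ℝ} {δr : ℕ → ℝ} (hδc : S.δc ≤ δ)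
    (hstep : ∀ (c : V) (Rπ : ℕ) (Wg : Sym2 V → unitInterval) (s : KNLevels.TStep (winGraph G c Rπ)), s.KitsAt Wg S.p Δ' δ₂ →
      1 - δ₂ < (prodBernoulli Wg).real s.L.reachB → 1 - S.δc / 2 < (prodBernoulli Wg).real (⋃ t ∈ s.T, openConn s.L.o t))
    (hchain : ∀ n ≤ nmaxC, ∀ (Ω : Finset V) (Wg : Sym2 V → unitInterval) (s : Fin (n + 1) → KNLevels.TStep (winGraphIn G Ω))
      (T' : Fin (n + 1) → Finset V) (η : ℝ),
      (∀ i : Fin (n + 1), (s i).L.o = (s 0).L.o) →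
      (∀ i : Fin n, T' (Fin.castSucc i) ⊆ (s i.succ).L.X 0) →
      (∀ i : Fin (n + 1), T' i ⊆ (s i).T) →
      (∀ i : Fin (n + 1), (s i).KitsAt Wg S.p Δ' δ) →
      η ≤ δ / 2 →
      (∀ i : Fin (n + 1), (prodBernoulli Wg).real (⋃ t ∈ (s i).T \ T' i, openConn (s 0).L.o t) ≤ η) →
      1 - δ < (prodBernoulli Wg).real (s 0).L.reachB →
        1 - ε'' < (prodBernoulli Wg).real (⋃ t ∈ T' (Fin.last n), openConn (s 0).L.o t))
    (hchainr : ∀ (n : ℕ) (c : V) (Rπ : ℕ) (Wg : Sym2 V → unitInterval) (s : Fin (n + 1) → KNLevels.TStep (winGraph G c Rπ))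
      (T' : Fin (n + 1) → Finset V) (η : ℝ),
      (∀ i : Fin (n + 1), (s i).L.o = (s 0).L.o) →
      (∀ i : Fin n, T' (Fin.castSucc i) ⊆ (s i.succ).L.X 0) →
      (∀ i : Fin (n + 1), T' i ⊆ (s i).T) →
      (∀ i : Fin (n + 1), (s i).KitsAt Wg S.p Δ' (δr n)) →
      η ≤ δr n / 2 →
      (∀ i : Fin (n + 1), (prodBernoulli Wg).real (⋃ t ∈ (s i).T \ T' i, openConn (s 0).L.o t) ≤ η) →
      1 - δr n < (prodBernoulli Wg).real (s 0).L.reachB →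
        1 - S.δc < (prodBernoulli Wg).real (⋃ t ∈ T' (Fin.last n), openConn (s 0).L.o t))
    (hQ0 : RootOblTO G S Δ' δr) (hface : FaceOblRO G φ S FD Δ' δ₂) (hreach : ReachOblRHO G S FD Δ' δ) :
    KSchA.KitAtRunO G S FD δ₂ ε'' := by
  refine And.intro (Skel.rootObl_of_rootOblTO hchainr hQ0) (And.intro ?_ ?_)
  · intro h e hrun hc hV du hdu j hj o hsrc
    exact cond_of_faceOblAt hlip hstep (hface h e hrun hc hV du hdu j hj o) hsrc
  · intro h e hrun hc hV du hdu
    exact Skel.reach_of_reachOblAtHO hV hδc hchain (hreach h e hrun hc hV du hdu)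

end Skelφ

/-! ## §3 Bridges: the structure-level face residue is the φ-level one (by `Iff.rfl`) -/

namespace Skel

open Literature.Probability.Percolation Literature.Probability.LatticeModels KNCells
open GadgetSystem ProbeHistory HSiteScheme Contour

variable {V : Type} [DecidableEq V] [Countable V] {G : SimpleGraph V} [G.LocallyFinite] (Φ : PlanarSkeletonConc G) {A : Type*}

omit [Countable V] in
/-- `Skel.FaceOblRO Φ` is the φ-level `Skelφ.FaceOblRO G Φ.φ`. [folklore] -/
theorem faceOblR_iff_skelφO (S : KSchA V A) (FD : FaceData V A) (Δ' : ℕ) (δ₂ : ℝ) :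
    FaceOblRO Φ S FD Δ' δ₂ ↔ Skelφ.FaceOblRO G Φ.φ S FD Δ' δ₂ := Iff.rfl

end Skel

end Summit.CriticalPhenomena.PercolationContinuityZ3.Theorems.Transplant

end
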